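import Literature.NumberTheory.LFunctions.LargeValuesFourierDecay
import Mathlib.Analysis.Fourier.Inversion
import Mathlib.Analysis.SpecialFunctions.JapaneseBracket
import HarnessLib

/-!
# Fourier decay and inversion for compactly supported `C^m` functions on `ℝ`

Support file for the proof of the Cohn–Kumar–Miller–Radchenko–Viazovska interpolation theorem
(`Literature/Analysis/Fourier/RadialSchwartzInterpolation.lean`). In the proof of CKMRV
Lemma 2.2 a compactly supported function `g` on `ℝ` is recovered from its Fourier transform,
"`g(|x|²) = ∫ ĝ(t) e^{2πit|x|²} dt` by Fourier inversion", with `ĝ` rapidly decreasing. We need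
the finite-smoothness version with quantitative decay: for `H ∈ C^m_c(ℝ)`,

* `‖Ĥ(t)‖ (1 + |t|)ᵐ ≤ C` (`exists_bound_one_add_abs_pow_mul_norm_fourier`), from Mathlib's
  `Real.fourier_iteratedDeriv` (`𝓕(H⁽ᵐ⁾) = (2πit)ᵐ Ĥ`) and `‖𝓕 F‖_∞ ≤ ‖F‖₁`;
* hence `Ĥ` and its moments `(1+|t|)ᵏ |Ĥ(t)|`, `k + 2 ≤ m`, are integrable
  (`integrable_one_add_abs_pow_mul_norm_fourier`);
* and the inversion formula in integral form, `H(s) = ∫ Ĥ(t) e^{2πits} dt`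
  (`eq_integral_fourier_mul_cexp`), from Mathlib's `Continuous.fourierInv_fourier_eq`.

Everything is proved (theorems only); no named facts. The elementary facts
`hasCompactSupport_iteratedDeriv` and `‖𝓕 f‖_∞ ≤ ‖f‖₁` are reused from the tree
(`Literature.NumberTheory.LFunctions.GuthMaynardFourier`, file
`Literature/NumberTheory/LFunctions/LargeValuesFourierDecay.lean`).

## References

* H. Cohn, A. Kumar, S. D. Miller, D. Radchenko, M. Viazovska, *Universal optimality of the `E₈`
  and Leech lattices and interpolation formulas*, Ann. of Math. 196 (2022), §2.3, proof of
  Lemma 2.2. [CohnEtAl2019]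
-/

noncomputable section

open scoped Topology ContDiff FourierTransform RealInnerProductSpace
open Filter Set MeasureTheory Complex

namespace Literature.Analysis.Fourier

/-! ## Compactly supported `C^m` functions: integrable derivatives -/

/-- The iterated derivatives (up to the smoothness) of a compactly supported `C^m` function are
integrable. [folklore] -/
theorem integrable_iteratedDeriv_of_hasCompactSupport {H : ℝ → ℂ} {m : ℕ} (hH : ContDiff ℝ m H)
    (hHc : HasCompactSupport H) {n : ℕ} (hn : n ≤ m) : Integrable (iteratedDeriv n H) :=
  (hH.continuous_iteratedDeriv n (by exact_mod_cast hn)).integrable_of_hasCompactSupport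
    (NumberTheory.LFunctions.GuthMaynardFourier.hasCompactSupport_iteratedDeriv hHc n)

/-! ## Decay of the Fourier transform -/

/-- `(1 + |t|)ᵐ ≤ 2ᵐ (1 + |t|ᵐ)`. [folklore] -/
theorem one_add_abs_pow_le_two_pow_mul (t : ℝ) (m : ℕ) : (1 + |t|) ^ m ≤ 2 ^ m * (1 + |t| ^ m) := by
  have h1 : 1 + |t| ≤ 2 * max 1 |t| := by
    rcases le_total 1 |t| with h | h
    · rw [max_eq_right h]; linarith
    · rw [max_eq_left h]; linarith
  have h2 : (max 1 |t|) ^ m ≤ 1 + |t| ^ m := by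
    rcases le_total 1 |t| with h | h
    · rw [max_eq_right h]; linarith [pow_nonneg (abs_nonneg t) m, (one_pow m : (1 : ℝ) ^ m = 1)]
    · rw [max_eq_left h, one_pow]; linarith [pow_nonneg (abs_nonneg t) m]
  calc (1 + |t|) ^ m ≤ (2 * max 1 |t|) ^ m := pow_le_pow_left₀ (by positivity) h1 m
    _ = 2 ^ m * (max 1 |t|) ^ m := mul_pow _ _ _
    _ ≤ 2 ^ m * (1 + |t| ^ m) := mul_le_mul_of_nonneg_left h2 (by positivity)

/-- **Polynomial decay of the Fourier transform of a `C^m_c` function on `ℝ`:**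
`(1 + |t|)ᵐ ‖Ĥ(t)‖ ≤ C` with `C = 2ᵐ (‖H‖₁ + ‖H⁽ᵐ⁾‖₁/(2π)ᵐ)`, from `𝓕(H⁽ᵐ⁾)(t) = (2πit)ᵐ Ĥ(t)`
(Mathlib's `Real.fourier_iteratedDeriv`) and `‖𝓕 F‖_∞ ≤ ‖F‖₁`. [folklore] -/
theorem one_add_abs_pow_mul_norm_fourier_le {H : ℝ → ℂ} {m : ℕ} (hH : ContDiff ℝ m H)
    (hHc : HasCompactSupport H) (t : ℝ) :
    (1 + |t|) ^ m * ‖𝓕 H t‖ ≤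
      2 ^ m * ((∫ s, ‖H s‖) + (∫ s, ‖iteratedDeriv m H s‖) / (2 * Real.pi) ^ m) := by
  have hint : ∀ n : ℕ, (n : ℕ∞) ≤ m → Integrable (iteratedDeriv n H) := fun n hn =>
    integrable_iteratedDeriv_of_hasCompactSupport hH hHc (by exact_mod_cast hn)
  have hF := Real.fourier_iteratedDeriv (N := m) hH hint le_rfl
  have h0 : ‖𝓕 H t‖ ≤ ∫ s, ‖H s‖ :=
    NumberTheory.LFunctions.GuthMaynardFourier.norm_fourier_le_integral_norm H t
  have hm : (2 * Real.pi * |t|) ^ m * ‖𝓕 H t‖ ≤ ∫ s, ‖iteratedDeriv m H s‖ := by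
    have h1 : ‖𝓕 (iteratedDeriv m H) t‖ ≤ ∫ s, ‖iteratedDeriv m H s‖ :=
      NumberTheory.LFunctions.GuthMaynardFourier.norm_fourier_le_integral_norm _ t
    rw [hF] at h1
    simp only [norm_smul, norm_pow, norm_mul, Complex.norm_ofNat, Complex.norm_real,
      Real.norm_eq_abs, abs_of_pos Real.pi_pos, Complex.norm_I, mul_one] at h1
    exact h1
  have hpi : 0 < (2 * Real.pi) ^ m := by positivity
  have hm' : |t| ^ m * ‖𝓕 H t‖ ≤ (∫ s, ‖iteratedDeriv m H s‖) / (2 * Real.pi) ^ m := by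
    rw [le_div_iff₀ hpi]
    calc |t| ^ m * ‖𝓕 H t‖ * (2 * Real.pi) ^ m = (2 * Real.pi * |t|) ^ m * ‖𝓕 H t‖ := by
          rw [mul_pow]; ring
      _ ≤ _ := hm
  calc (1 + |t|) ^ m * ‖𝓕 H t‖ ≤ 2 ^ m * (1 + |t| ^ m) * ‖𝓕 H t‖ :=
        mul_le_mul_of_nonneg_right (one_add_abs_pow_le_two_pow_mul t m) (norm_nonneg _)
    _ = 2 ^ m * (‖𝓕 H t‖ + |t| ^ m * ‖𝓕 H t‖) := by ring
    _ ≤ 2 ^ m * ((∫ s, ‖H s‖) + (∫ s, ‖iteratedDeriv m H s‖) / (2 * Real.pi) ^ m) := by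
        gcongr

/-- Existence form: `∃ C, ∀ t, (1+|t|)ᵐ ‖Ĥ(t)‖ ≤ C` for `H ∈ C^m_c(ℝ)`. [folklore] -/
theorem exists_bound_one_add_abs_pow_mul_norm_fourier {H : ℝ → ℂ} {m : ℕ} (hH : ContDiff ℝ m H)
    (hHc : HasCompactSupport H) : ∃ C, 0 ≤ C ∧ ∀ t : ℝ, (1 + |t|) ^ m * ‖𝓕 H t‖ ≤ C :=
  ⟨_, le_trans (by positivity) (one_add_abs_pow_mul_norm_fourier_le hH hHc 0),
    one_add_abs_pow_mul_norm_fourier_le hH hHc⟩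

/-- The Fourier transform of an integrable function on `ℝ` is continuous. [folklore] -/
theorem continuous_fourier_real {H : ℝ → ℂ} (hH : Integrable H) : Continuous (𝓕 H) :=
  VectorFourier.fourierIntegral_continuous Real.continuous_fourierChar
    (by exact continuous_inner) hH

/-- `(1 + |t|)^{-2}` is integrable on `ℝ`. [folklore] -/
theorem integrable_one_add_abs_pow_neg_two : Integrable fun t : ℝ => ((1 + |t|) ^ 2)⁻¹ := by
  have h := integrable_one_add_norm (E := ℝ) (μ := volume) (r := 2) (by simp)
  refine h.congr (Eventually.of_forall fun t => ?_)
  simp only [Real.norm_eq_abs]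
  rw [Real.rpow_neg (by positivity), Real.rpow_two]

/-- **Integrable moments of the Fourier transform of a `C^m_c` function:** for `k + 2 ≤ m`,
`t ↦ (1 + |t|)ᵏ ‖Ĥ(t)‖` is integrable (dominated by `C (1+|t|)^{−2}`). [folklore] -/
theorem integrable_one_add_abs_pow_mul_norm_fourier {H : ℝ → ℂ} {m k : ℕ} (hH : ContDiff ℝ m H)
    (hHc : HasCompactSupport H) (hk : k + 2 ≤ m) :
    Integrable fun t : ℝ => (1 + |t|) ^ k * ‖𝓕 H t‖ := by
  obtain ⟨C, hC0, hC⟩ := exists_bound_one_add_abs_pow_mul_norm_fourier hH hHc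
  have hHi : Integrable H := hH.continuous.integrable_of_hasCompactSupport hHc
  have hcont : Continuous fun t : ℝ => (1 + |t|) ^ k * ‖𝓕 H t‖ := by
    have := continuous_fourier_real hHi
    fun_prop
  refine (integrable_one_add_abs_pow_neg_two.const_mul C).mono' hcont.aestronglyMeasurable
    (Eventually.of_forall fun t => ?_)
  rw [Real.norm_of_nonneg (by positivity)]
  have h1 : 1 ≤ 1 + |t| := by linarith [abs_nonneg t]
  have hpos : 0 < (1 + |t|) ^ 2 := by positivity
  rw [← div_eq_mul_inv, le_div_iff₀ hpos]
  calc (1 + |t|) ^ k * ‖𝓕 H t‖ * (1 + |t|) ^ 2 = (1 + |t|) ^ (k + 2) * ‖𝓕 H t‖ := by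
        rw [pow_add]; ring
    _ ≤ (1 + |t|) ^ m * ‖𝓕 H t‖ :=
        mul_le_mul_of_nonneg_right (pow_le_pow_right₀ h1 hk) (norm_nonneg _)
    _ ≤ C := hC t

/-- The Fourier transform of a `C^m_c` function (`m ≥ 2`) is integrable. [folklore] -/
theorem integrable_fourier_of_contDiff {H : ℝ → ℂ} {m : ℕ} (hH : ContDiff ℝ m H)
    (hHc : HasCompactSupport H) (hm : 2 ≤ m) : Integrable (𝓕 H) := by
  have h := integrable_one_add_abs_pow_mul_norm_fourier (k := 0) hH hHc (by omega)
  simp only [pow_zero, one_mul] at h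
  have hHi : Integrable H := hH.continuous.integrable_of_hasCompactSupport hHc
  exact (integrable_norm_iff (continuous_fourier_real hHi).aestronglyMeasurable).1 h

/-! ## Fourier inversion in integral form -/

/-- **Fourier inversion for `C^m_c` functions (`m ≥ 2`), integral form:**
`H(s) = ∫ Ĥ(t) e^{2πits} dt` for all `s` (Mathlib's `Continuous.fourierInv_fourier_eq`).
[folklore] -/
theorem eq_integral_fourier_mul_cexp {H : ℝ → ℂ} {m : ℕ} (hH : ContDiff ℝ m H)
    (hHc : HasCompactSupport H) (hm : 2 ≤ m) (s : ℝ) :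
    H s = ∫ t : ℝ, 𝓕 H t * cexp (2 * Real.pi * I * t * s) := by
  have hHi : Integrable H := hH.continuous.integrable_of_hasCompactSupport hHc
  have hinv := hH.continuous.fourierInv_fourier_eq hHi (integrable_fourier_of_contDiff hH hHc hm)
  conv_lhs => rw [← hinv]
  rw [Real.fourierInv_eq']
  congr 1; funext t
  rw [smul_eq_mul, mul_comm]
  congr 1
  simp only [RCLike.inner_apply, conj_trivial]
  push_cast
  ring_nf

end Literature.Analysis.Fourier
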